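import Literature.MathematicalPhysics.KineticTheory.ConfinedDynkin
import HarnessLib

/-!
# The Langevin chain with confining potentials: its transition semigroup from the model-free SDE pipeline

Topic `Literature/MathematicalPhysics/KineticTheory` (trunk T-KINETIC). For an oscillator chain
`P : OscillatorChain` (pinning `U`, coupling `V`, friction `γ`) between Langevin heat baths at
temperatures `T_L, T_R` (Bonetto–Lebowitz–Rey-Bellet 2000 eq. (10); Cuneo–Eckmann–Hairer–Rey-Bellet
2018 eq. (2.2); Hairer–Mattingly 2009 §1) the equations of motion are the additive-noise SDE

  `dz = Y(z) dt + v_L dB^L + v_R dB^R`,  `Y(q, p) = (p, -∇_q H - γ 1_B p)`,  `v_b = √(2γT_b) ∂_{p_b}`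

on phase space `PhaseSpace N = ℝ^N × ℝ^N`, with the drift `OscillatorChain.drift` and the bath
directions `bathVec`. `LangevinChainSDE.lean` … `LangevinChainDynkin.lean` constructed its transition
semigroup for ONE family (`pinnedChain`, `ω₂ > 0`). This file does it for EVERY chain whose
potentials are CONFINING in the elementary sense of the hypothesis structure
`OscillatorChain.IsConfining` — `U, V ∈ C²`, `U, V ≥ 0`, `|U'| ≤ A(1 + U)`, `|V'| ≤ B(1 + V)`,
`γ ≥ 0`, `U(q) → ∞` as `|q| → ∞` (e.g. the Hairer–Mattingly chain `|q|^{2k}/2k`, `q²/2`, `k > 3/2`;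
the `φ⁴` chain; `pinnedChain`) — by instantiating the MODEL-FREE pipeline
`ConfinedForcedFlow` → `ConfinedDriftKernel` → `ConfinedFlowBounds` → `ConfinedGeneratorStep` →
`ConfinedDynkin`:

* `OscillatorChain.IsConfining.confinedDrift` — the Langevin drift `Y = P.drift N` is a
  `RegularConfinedDrift` with energy `H` (the deterministic energy balance
  `DH(y)·Y(y + (0,e)) = ∑ ∂_{q_i}H e_i - γ∑_B p_i² - γ∑_B p_i e_i`, the linear energy bound
  `∑|∂_{q_i}H| + 2γ∑|p_i| ≤ K_E (1 + H)` and the coercivity of `H`);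
* `OscillatorChain.langevinKernel` — the transition kernels `P_t(x, ·) = law(Φ_t(x, B))`
  (`sdeKernel` of the pipeline); under `IsConfining`: Markov, jointly measurable, `P_0 = id`,
  Chapman–Kolmogorov, Feller (`IsConfining.continuous_integral_langevinKernel`), and Dynkin's
  identity `P_t f - f = ∫₀ᵗ P_s(Lf) ds` for `f ∈ C²_c` with `L = P.generator N T_L T_R`
  (`IsConfining.langevinKernel_dynkin`; `sdeGenerator = generator` is `generator_eq_fderiv_add_half`);
* `OscillatorChain.IsConfining.semigroup` — the package as a `LangevinChainSemigroup P N T_L T_R`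
  (`N ≥ 1`, `T_L, T_R ≥ 0`), the interface of `LangevinSemigroup.lean` in which the NESS facts of the
  heat-conduction cone are stated (`CuneoEckmannHairerReyBellet2018_thm213`,
  `Literature.Barriers.AtomisticToContinuum.HairerMattingly2009_threeOscillators`).

## References

* R. Khasminskii, *Stochastic Stability of Differential Equations* (2nd ed., Springer 2012),
  Thm 3.5 (regularity / non-explosion from a Lyapunov function with `LV ≤ cV`), §3.4.
* M. Hairer, J. C. Mattingly, *Slow energy dissipation in anharmonic oscillator chains*,
  Comm. Pure Appl. Math. **62** (2009) 999–1032, §1 (the model), Prop. 5.1 ("Consider a SDE on `ℝⁿ`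
  with smooth coefficients having global solutions and generator `L`").
* N. Cuneo, J.-P. Eckmann, M. Hairer, L. Rey-Bellet, Electron. J. Probab. **23** (2018) no. 55,
  eq. (2.2)–(2.3) and §3 eq. (3.2)–(3.3).
-/

noncomputable section

open MeasureTheory ProbabilityTheory Filter Topology Set Metric
open scoped NNReal ENNReal

/-! ### A monotone radius function for the sublevel sets of a proper function -/

namespace Literature.MathematicalPhysics.KineticTheory

variable {E : Type*} [NormedAddCommGroup E]

/-- The least nonnegative radius `ρ(B)` of a ball about `0` containing the sublevel set `{V ≤ B}`
(meaningful when the sublevel sets are bounded). [folklore] -/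
def levelRadius (V : E → ℝ) (B : ℝ) : ℝ :=
  sInf {r : ℝ | 0 ≤ r ∧ ∀ y : E, V y ≤ B → ‖y‖ ≤ r}

/-- Compact sublevel sets admit admissible radii. [folklore] -/
theorem exists_admissible_levelRadius {V : E → ℝ} (hcpt : ∀ B : ℝ, IsCompact {x : E | V x ≤ B})
    (B : ℝ) : ∃ r : ℝ, 0 ≤ r ∧ ∀ y : E, V y ≤ B → ‖y‖ ≤ r := by
  obtain ⟨r, hr⟩ := (hcpt B).isBounded.subset_closedBall 0
  refine ⟨max r 0, le_max_right _ _, fun y hy => ?_⟩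
  have := hr (show y ∈ {x : E | V x ≤ B} from hy)
  rw [mem_closedBall, dist_zero_right] at this
  exact this.trans (le_max_left _ _)

/-- `V y ≤ B ⟹ ‖y‖ ≤ ρ(B)` (compact sublevel sets). [folklore] -/
theorem norm_le_levelRadius {V : E → ℝ} (hcpt : ∀ B : ℝ, IsCompact {x : E | V x ≤ B})
    {y : E} {B : ℝ} (hy : V y ≤ B) : ‖y‖ ≤ levelRadius V B := by
  obtain ⟨r, hr0, hr⟩ := exists_admissible_levelRadius hcpt B
  exact le_csInf ⟨r, hr0, hr⟩ fun r' hr' => hr'.2 y hy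

/-- The radius is monotone in the level (compact sublevel sets). [folklore] -/
theorem levelRadius_mono {V : E → ℝ} (hcpt : ∀ B : ℝ, IsCompact {x : E | V x ≤ B}) :
    Monotone (levelRadius V) := by
  intro B B' hBB'
  obtain ⟨r, hr0, hr⟩ := exists_admissible_levelRadius hcpt B'
  refine csInf_le_csInf ⟨0, fun r' hr' => hr'.1⟩ ⟨r, hr0, hr⟩ fun r' hr' => ?_
  exact ⟨hr'.1, fun y hy => hr'.2 y (hy.trans hBB')⟩

end Literature.MathematicalPhysics.KineticTheory

namespace Literature.MathematicalPhysics.KineticTheory.HeatConduction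

open Literature.Probability.Process Literature.MathematicalPhysics.KineticTheory

variable {N : ℕ}

/-! ### The momentum subspace (where the bath noise acts) -/

/-- The momentum subspace `{0} × ℝ^N` of phase space: the additive bath noise `√(2γT_b) dB^b ∂_{p_b}`
acts in momentum directions only. [folklore] -/
def momentumSubspace (N : ℕ) : Submodule ℝ (PhaseSpace N) :=
  (⊥ : Submodule ℝ (Fin N → ℝ)).prod ⊤

/-- Membership in the momentum subspace: the position component vanishes. [folklore] -/
theorem mem_momentumSubspace {e : PhaseSpace N} : e ∈ momentumSubspace N ↔ e.1 = 0 := by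
  simp [momentumSubspace, Submodule.mem_prod]

/-- The bath directions `bathVec N k c = (0, c 1_{i = k})` are momentum directions. [folklore] -/
theorem bathVec_mem_momentumSubspace (N k : ℕ) (c : ℝ) : bathVec N k c ∈ momentumSubspace N :=
  mem_momentumSubspace.2 rfl

/-- A momentum vector `e = (0, e₂)` shifts `y` to `(y.1, y.2 + e.2)`. [folklore] -/
theorem add_eq_of_mem_momentumSubspace {e : PhaseSpace N} (he : e ∈ momentumSubspace N)
    (y : PhaseSpace N) : y + e = (y.1, y.2 + e.2) := by
  rw [mem_momentumSubspace] at he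
  ext i
  · simp [he]
  · rfl

/-- For a momentum vector, `‖e‖ = ‖e.2‖`. [folklore] -/
theorem norm_eq_of_mem_momentumSubspace {e : PhaseSpace N} (he : e ∈ momentumSubspace N) :
    ‖e‖ = ‖e.2‖ := by
  rw [mem_momentumSubspace] at he
  rw [Prod.norm_def, he, norm_zero, max_eq_right (norm_nonneg _)]

namespace OscillatorChain

/-! ### The hypothesis structure -/

/-- **Confining potentials** for an oscillator chain `P = (U, V, γ)`: `U, V ∈ C²` and nonnegative,
with derivatives dominated by the potentials themselves, `|U'(q)| ≤ A (1 + U(q))`,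
`|V'(r)| ≤ B (1 + V(r))` (polynomial-type growth), nonnegative friction `γ ≥ 0`, and a pinning
that grows at infinity, `U(q) → ∞` as `|q| → ∞`. Under these hypotheses the energy `H` is
nonnegative, `C²`, coercive, and obeys the linear energy balance along the Langevin dynamics driven
by a bounded momentum forcing — exactly the input of the model-free SDE pipeline
(`ConfinedForcedFlow.lean`: "a Hamiltonian system with friction and additive forcing").
Instances: the Hairer–Mattingly chain `U = |q|^{2k}/2k` (`k > 3/2`), `V = r²/2`; `pinnedChain`;
the `φ⁴` chain. [folklore] -/
structure IsConfining (P : OscillatorChain) : Prop where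
  contDiff_U : ContDiff ℝ 2 P.U
  contDiff_V : ContDiff ℝ 2 P.V
  γ_nonneg : 0 ≤ P.γ
  U_nonneg : ∀ q, 0 ≤ P.U q
  V_nonneg : ∀ r, 0 ≤ P.V r
  exists_abs_deriv_U_le : ∃ A : ℝ, 0 ≤ A ∧ ∀ q, |deriv P.U q| ≤ A * (1 + P.U q)
  exists_abs_deriv_V_le : ∃ B : ℝ, 0 ≤ B ∧ ∀ r, |deriv P.V r| ≤ B * (1 + P.V r)
  tendsto_U : Tendsto P.U (cocompact ℝ) atTop

variable (P : OscillatorChain)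

/-! ### Energy inequalities for nonnegative potentials -/

/-- The interaction energy is nonnegative when `V ≥ 0`. [folklore] -/
theorem interaction_nonneg (hV0 : ∀ r, 0 ≤ P.V r) (N : ℕ) (q : Fin N → ℝ) :
    0 ≤ ∑ i : Fin N, ∑ j : Fin N, (if j.val = i.val + 1 then P.V (q j - q i) else 0) :=
  Finset.sum_nonneg fun i _ => Finset.sum_nonneg fun j _ => by
    split_ifs
    · exact hV0 _
    · exact le_rfl

/-- Each site energy is dominated by the total energy: `p_i²/2 + U(q_i) ≤ H` (`U, V ≥ 0`).
[folklore] -/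
theorem site_le_hamiltonian (hU0 : ∀ q, 0 ≤ P.U q) (hV0 : ∀ r, 0 ≤ P.V r) (N : ℕ)
    (x : PhaseSpace N) (i : Fin N) : x.2 i ^ 2 / 2 + P.U (x.1 i) ≤ P.hamiltonian N x := by
  unfold hamiltonian
  have h1 : x.2 i ^ 2 / 2 + P.U (x.1 i) ≤ ∑ k, (x.2 k ^ 2 / 2 + P.U (x.1 k)) :=
    Finset.single_le_sum (f := fun k => x.2 k ^ 2 / 2 + P.U (x.1 k))
      (fun k _ => add_nonneg (by positivity) (hU0 _)) (Finset.mem_univ i)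
  have h2 := P.interaction_nonneg hV0 N x.1
  linarith

/-- The energy is nonnegative when `U, V ≥ 0`. [folklore] -/
theorem hamiltonian_nonneg_of_nonneg (hU0 : ∀ q, 0 ≤ P.U q) (hV0 : ∀ r, 0 ≤ P.V r) (N : ℕ)
    (x : PhaseSpace N) : 0 ≤ P.hamiltonian N x := by
  unfold hamiltonian
  exact add_nonneg (Finset.sum_nonneg fun k _ => add_nonneg (by positivity) (hU0 _))
    (P.interaction_nonneg hV0 N x.1)

/-- The kinetic energy is dominated by the total energy: `∑ p_i²/2 ≤ H` (`U, V ≥ 0`). [folklore] -/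
theorem kinetic_le_hamiltonian_of_nonneg (hU0 : ∀ q, 0 ≤ P.U q) (hV0 : ∀ r, 0 ≤ P.V r) (N : ℕ)
    (x : PhaseSpace N) : ∑ i, x.2 i ^ 2 / 2 ≤ P.hamiltonian N x := by
  unfold hamiltonian
  have h1 : ∑ i, x.2 i ^ 2 / 2 ≤ ∑ k, (x.2 k ^ 2 / 2 + P.U (x.1 k)) :=
    Finset.sum_le_sum fun k _ => le_add_of_nonneg_right (hU0 _)
  have h2 := P.interaction_nonneg hV0 N x.1
  linarith

/-- Each bond energy is dominated by the total energy: `V(q_l - q_k) ≤ H` for `l = k + 1`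
(`U, V ≥ 0`). [folklore] -/
theorem bond_le_hamiltonian (hU0 : ∀ q, 0 ≤ P.U q) (hV0 : ∀ r, 0 ≤ P.V r) (N : ℕ)
    (x : PhaseSpace N) {k l : Fin N} (hlk : l.val = k.val + 1) :
    P.V (x.1 l - x.1 k) ≤ P.hamiltonian N x := by
  unfold hamiltonian
  have h1 : 0 ≤ ∑ i, (x.2 i ^ 2 / 2 + P.U (x.1 i)) :=
    Finset.sum_nonneg fun i _ => add_nonneg (by positivity) (hU0 _)
  have hin : (if l.val = k.val + 1 then P.V (x.1 l - x.1 k) else 0) ≤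
      ∑ j : Fin N, (if j.val = k.val + 1 then P.V (x.1 j - x.1 k) else 0) :=
    Finset.single_le_sum (f := fun j : Fin N => if j.val = k.val + 1 then P.V (x.1 j - x.1 k) else 0)
      (fun j _ => by
        split_ifs
        · exact hV0 _
        · exact le_rfl) (Finset.mem_univ l)
  rw [if_pos hlk] at hin
  have hout : ∑ j : Fin N, (if j.val = k.val + 1 then P.V (x.1 j - x.1 k) else 0) ≤
      ∑ i : Fin N, ∑ j : Fin N, (if j.val = i.val + 1 then P.V (x.1 j - x.1 i) else 0) :=
    Finset.single_le_sum
      (f := fun i : Fin N => ∑ j : Fin N, (if j.val = i.val + 1 then P.V (x.1 j - x.1 i) else 0))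
      (fun i _ => Finset.sum_nonneg fun j _ => by
        split_ifs
        · exact hV0 _
        · exact le_rfl) (Finset.mem_univ k)
  linarith

/-- `∑_i |p_i| ≤ N/2 + H` (`U, V ≥ 0`). [folklore] -/
theorem sum_abs_momentum_le (hU0 : ∀ q, 0 ≤ P.U q) (hV0 : ∀ r, 0 ≤ P.V r) (N : ℕ)
    (x : PhaseSpace N) : ∑ i, |x.2 i| ≤ N / 2 + P.hamiltonian N x := by
  have h := P.kinetic_le_hamiltonian_of_nonneg hU0 hV0 N x
  calc ∑ i, |x.2 i| ≤ ∑ i : Fin N, (1 / 2 + x.2 i ^ 2 / 2) :=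
        Finset.sum_le_sum fun i _ => abs_le_half_add_sq_half _
    _ = N / 2 + ∑ i, x.2 i ^ 2 / 2 := by
        rw [Finset.sum_add_distrib]
        simp only [Finset.sum_const, Finset.card_univ, Fintype.card_fin, nsmul_eq_mul]
        ring
    _ ≤ N / 2 + P.hamiltonian N x := by linarith

/-- `∑_i p_i² ≤ 2H` (`U, V ≥ 0`). [folklore] -/
theorem sum_sq_momentum_le (hU0 : ∀ q, 0 ≤ P.U q) (hV0 : ∀ r, 0 ≤ P.V r) (N : ℕ)
    (x : PhaseSpace N) : ∑ i, x.2 i ^ 2 ≤ 2 * P.hamiltonian N x := by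
  have h := P.kinetic_le_hamiltonian_of_nonneg hU0 hV0 N x
  have h2 : ∑ i, x.2 i ^ 2 = 2 * ∑ i, x.2 i ^ 2 / 2 := by
    rw [Finset.mul_sum]
    exact Finset.sum_congr rfl fun i _ => by ring
  rw [h2]
  linarith

/-! ### The linear force bound `∑ |∂_{q_i}H| ≤ K (1 + H)` -/

/-- **The force is dominated by the energy**: if `|U'| ≤ A(1 + U)` and `|V'| ≤ B(1 + V)`
(`A, B ≥ 0`, `U, V ≥ 0`) then `|∂Φ/∂q_i| ≤ (A + N² B)(1 + H)`. [folklore] -/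
theorem abs_dPotential_le {A B : ℝ} (hA0 : 0 ≤ A) (hB0 : 0 ≤ B)
    (hA : ∀ q, |deriv P.U q| ≤ A * (1 + P.U q)) (hB : ∀ r, |deriv P.V r| ≤ B * (1 + P.V r))
    (hU0 : ∀ q, 0 ≤ P.U q) (hV0 : ∀ r, 0 ≤ P.V r) (N : ℕ) (x : PhaseSpace N) (i : Fin N) :
    |P.dPotential N i x.1| ≤ (A + N ^ 2 * B) * (1 + P.hamiltonian N x) := by
  set H := P.hamiltonian N x with hH
  have hH0 : 0 ≤ H := P.hamiltonian_nonneg_of_nonneg hU0 hV0 N x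
  unfold dPotential
  refine (abs_add_le _ _).trans ?_
  have h1 : |deriv P.U (x.1 i)| ≤ A * (1 + H) := by
    refine (hA _).trans (mul_le_mul_of_nonneg_left ?_ hA0)
    have := P.site_le_hamiltonian hU0 hV0 N x i
    nlinarith [sq_nonneg (x.2 i)]
  have hkl : ∀ k l : Fin N, |(if l.val = k.val + 1 then
      deriv P.V (x.1 l - x.1 k) * ((if l = i then 1 else 0) - (if k = i then 1 else 0)) else 0)| ≤
      B * (1 + H) := by
    intro k l
    have hs : |((if l = i then (1 : ℝ) else 0) - (if k = i then 1 else 0))| ≤ 1 := by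
      split_ifs <;> norm_num
    have hnn : 0 ≤ B * (1 + H) := mul_nonneg hB0 (by linarith)
    by_cases hlk : l.val = k.val + 1
    · rw [if_pos hlk, abs_mul]
      have hV' : |deriv P.V (x.1 l - x.1 k)| ≤ B * (1 + H) :=
        (hB _).trans (mul_le_mul_of_nonneg_left
          (by linarith [P.bond_le_hamiltonian hU0 hV0 N x hlk]) hB0)
      calc |deriv P.V (x.1 l - x.1 k)| * |((if l = i then (1 : ℝ) else 0) - (if k = i then 1 else 0))|
          ≤ B * (1 + H) * 1 := mul_le_mul hV' hs (abs_nonneg _) hnn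
        _ = B * (1 + H) := mul_one _
    · rw [if_neg hlk, abs_zero]
      exact hnn
  have h2 : |∑ k : Fin N, ∑ l : Fin N, (if l.val = k.val + 1 then
      deriv P.V (x.1 l - x.1 k) * ((if l = i then 1 else 0) - (if k = i then 1 else 0)) else 0)| ≤
      N ^ 2 * B * (1 + H) := by
    refine (Finset.abs_sum_le_sum_abs _ _).trans ?_
    calc ∑ k : Fin N, |∑ l : Fin N, (if l.val = k.val + 1 then
          deriv P.V (x.1 l - x.1 k) * ((if l = i then 1 else 0) - (if k = i then 1 else 0)) else 0)|
        ≤ ∑ k : Fin N, ∑ l : Fin N, B * (1 + H) :=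
          Finset.sum_le_sum fun k _ => (Finset.abs_sum_le_sum_abs _ _).trans
            (Finset.sum_le_sum fun l _ => hkl k l)
      _ = N ^ 2 * B * (1 + H) := by simp; ring
  nlinarith

/-- **The linear force bound**: `∑_i |∂_{q_i}H(x)| ≤ N (A + N² B)(1 + H(x))` under the hypotheses
of `abs_dPotential_le` for `C¹` potentials. [folklore] -/
theorem sum_abs_partialQ_hamiltonian_le {A B : ℝ} (hA0 : 0 ≤ A) (hB0 : 0 ≤ B)
    (hA : ∀ q, |deriv P.U q| ≤ A * (1 + P.U q)) (hB : ∀ r, |deriv P.V r| ≤ B * (1 + P.V r))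
    (hU0 : ∀ q, 0 ≤ P.U q) (hV0 : ∀ r, 0 ≤ P.V r) (hUd : Differentiable ℝ P.U)
    (hVd : Differentiable ℝ P.V) (N : ℕ) (x : PhaseSpace N) :
    ∑ i, |partialQ i (P.hamiltonian N) x| ≤ N * (A + N ^ 2 * B) * (1 + P.hamiltonian N x) := by
  calc ∑ i, |partialQ i (P.hamiltonian N) x|
      ≤ ∑ _i : Fin N, (A + N ^ 2 * B) * (1 + P.hamiltonian N x) :=
        Finset.sum_le_sum fun i _ => by
          rw [P.partialQ_hamiltonian_eq_dPotential hUd hVd]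
          exact P.abs_dPotential_le hA0 hB0 hA hB hU0 hV0 N x i
    _ = N * (A + N ^ 2 * B) * (1 + P.hamiltonian N x) := by simp; ring

/-! ### Smoothness of the drift for `C²` potentials -/

/-- `∂Φ/∂q_i ∈ C^n` for `C^{n+1}` potentials (finite-order version of `contDiff_dPotential`).
[folklore] -/
theorem contDiff_dPotential_of_succ {n : WithTop ℕ∞} (hU : ContDiff ℝ (n + 1) P.U)
    (hV : ContDiff ℝ (n + 1) P.V) (N : ℕ) (i : Fin N) : ContDiff ℝ n (P.dPotential N i) := by
  have hU' : ContDiff ℝ n (deriv P.U) := hU.deriv'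
  have hV' : ContDiff ℝ n (deriv P.V) := hV.deriv'
  have hq : ∀ m : Fin N, ContDiff ℝ n fun q : Fin N → ℝ => q m := fun m => contDiff_apply ℝ ℝ m
  unfold dPotential
  refine (hU'.comp (hq i)).add (ContDiff.sum fun k _ => ContDiff.sum fun l _ => ?_)
  by_cases hlk : l.val = k.val + 1
  · simp only [hlk, if_true]
    exact (hV'.comp ((hq l).sub (hq k))).mul contDiff_const
  · simp only [hlk, if_false]
    exact contDiff_const

/-- **The Langevin drift is `C¹` for `C²` potentials.** [folklore] -/
theorem contDiff_one_drift (hU : ContDiff ℝ 2 P.U) (hV : ContDiff ℝ 2 P.V) (N : ℕ) :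
    ContDiff ℝ 1 (P.drift N) := by
  have h2 : (2 : WithTop ℕ∞) = 1 + 1 := by norm_num
  rw [h2] at hU hV
  have hUd : Differentiable ℝ P.U := hU.differentiable (by norm_num)
  have hVd : Differentiable ℝ P.V := hV.differentiable (by norm_num)
  rw [P.drift_eq hUd hVd]
  refine contDiff_snd.prodMk (contDiff_pi.2 fun i => ?_)
  exact (((P.contDiff_dPotential_of_succ hU hV N i).comp contDiff_fst).neg).sub
    (contDiff_const.mul ((contDiff_apply ℝ ℝ i).comp contDiff_snd))

/-! ### The energy balance along the driven Langevin dynamics -/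

/-- **The energy identity**: for the Langevin drift `Y` and a momentum perturbation `e`,
`DH(y)·Y(y.1, y.2 + e) = ∑_i (∂_{q_i}H(y) e_i - γ w_i p_i² - γ w_i p_i e_i)`
(`w_i = [i = 0] + [i = N-1]`): the Hamiltonian vector field conserves `H`, the friction
dissipates, the forcing injects. [cite: CuneoEckmannHairerReyBellet2018, §3 eq. (3.3)] -/
theorem fderiv_hamiltonian_drift_eq_sum (hH : Differentiable ℝ (P.hamiltonian N)) (y : PhaseSpace N)
    (e : Fin N → ℝ) :
    fderiv ℝ (P.hamiltonian N) y (P.drift N (y.1, y.2 + e)) =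
      ∑ i, (partialQ i (P.hamiltonian N) y * e i - P.γ * bathWeight N i * y.2 i ^ 2 -
        P.γ * bathWeight N i * y.2 i * e i) := by
  rw [P.fderiv_hamiltonian_apply hH]
  simp only [drift, P.partialQ_hamiltonian_fst, Pi.add_apply]
  exact Finset.sum_congr rfl fun i _ => by ring

/-- **The lower energy bound**: `DH(y)·Y(y.1, y.2 + e) ≥ -‖e‖(∑|∂_{q_i}H| + 2γ∑|p_i|) - 2γ ∑ p_i²`
(`γ ≥ 0`). [folklore] -/
theorem fderiv_hamiltonian_drift_ge (hH : Differentiable ℝ (P.hamiltonian N)) (hγ : 0 ≤ P.γ)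
    (y : PhaseSpace N) (e : Fin N → ℝ) :
    -(‖e‖ * ((∑ i, |partialQ i (P.hamiltonian N) y|) + 2 * P.γ * ∑ i, |y.2 i|) +
        2 * P.γ * ∑ i, y.2 i ^ 2) ≤
      fderiv ℝ (P.hamiltonian N) y (P.drift N (y.1, y.2 + e)) := by
  rw [P.fderiv_hamiltonian_drift_eq_sum hH]
  have hr : -(‖e‖ * ((∑ i, |partialQ i (P.hamiltonian N) y|) + 2 * P.γ * ∑ i, |y.2 i|) +
      2 * P.γ * ∑ i, y.2 i ^ 2) =
      ∑ i, (-(‖e‖ * |partialQ i (P.hamiltonian N) y|) - ‖e‖ * 2 * P.γ * |y.2 i| -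
        2 * P.γ * y.2 i ^ 2) := by
    rw [mul_add, Finset.mul_sum, Finset.mul_sum, Finset.mul_sum, Finset.mul_sum]
    rw [show ∑ i, (-(‖e‖ * |partialQ i (P.hamiltonian N) y|) - ‖e‖ * 2 * P.γ * |y.2 i| -
        2 * P.γ * y.2 i ^ 2) = -((∑ i, ‖e‖ * |partialQ i (P.hamiltonian N) y|) +
          ∑ i, ‖e‖ * (2 * P.γ * |y.2 i|)) - ∑ i, 2 * P.γ * y.2 i ^ 2 + 0 by
      rw [← Finset.sum_add_distrib, ← Finset.sum_neg_distrib, ← Finset.sum_sub_distrib, add_zero]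
      exact Finset.sum_congr rfl fun i _ => by ring]
    ring
  rw [hr]
  refine Finset.sum_le_sum fun i _ => ?_
  set a := partialQ i (P.hamiltonian N) y
  set p := y.2 i
  have he : |e i| ≤ ‖e‖ := by rw [← Real.norm_eq_abs]; exact norm_le_pi_norm e i
  have hw0 : 0 ≤ bathWeight N i := by unfold bathWeight; split_ifs <;> norm_num
  have hw2 : bathWeight N i ≤ 2 := by unfold bathWeight; split_ifs <;> norm_num
  have h1 : -(‖e‖ * |a|) ≤ a * e i := by
    have : |a * e i| ≤ ‖e‖ * |a| := by
      rw [abs_mul, mul_comm]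
      exact mul_le_mul_of_nonneg_right he (abs_nonneg _)
    linarith [neg_abs_le (a * e i)]
  have h2 : -(2 * P.γ * p ^ 2) ≤ -(P.γ * bathWeight N i * p ^ 2) := by
    have : P.γ * bathWeight N i * p ^ 2 ≤ P.γ * 2 * p ^ 2 :=
      mul_le_mul_of_nonneg_right (mul_le_mul_of_nonneg_left hw2 hγ) (sq_nonneg p)
    linarith
  have h3 : -(‖e‖ * 2 * P.γ * |p|) ≤ -(P.γ * bathWeight N i * p * e i) := by
    have : |P.γ * bathWeight N i * p * e i| ≤ ‖e‖ * 2 * P.γ * |p| := by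
      calc |P.γ * bathWeight N i * p * e i| = P.γ * bathWeight N i * (|p| * |e i|) := by
            rw [abs_mul, abs_mul, abs_mul, abs_of_nonneg hγ, abs_of_nonneg hw0]; ring
        _ ≤ P.γ * 2 * (|p| * ‖e‖) := by
            refine mul_le_mul (mul_le_mul_of_nonneg_left hw2 hγ)
              (mul_le_mul_of_nonneg_left he (abs_nonneg _)) (by positivity) (by positivity)
        _ = ‖e‖ * 2 * P.γ * |p| := by ring
    linarith [le_abs_self (P.γ * bathWeight N i * p * e i)]
  linarith

/-- **The energy shift under a momentum translation**: `H(q, p + e) - H(q, p) = ∑_i (p_i e_i + e_i²/2)`.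
[folklore] -/
theorem hamiltonian_momentum_shift (N : ℕ) (y : PhaseSpace N) (e : Fin N → ℝ) :
    P.hamiltonian N (y.1, y.2 + e) - P.hamiltonian N y = ∑ i, (y.2 i * e i + e i ^ 2 / 2) := by
  rw [P.hamiltonian_eq_kinetic_add_potential, P.hamiltonian_eq_kinetic_add_potential]
  simp only [Pi.add_apply, add_sub_add_right_eq_sub, ← Finset.sum_sub_distrib]
  exact Finset.sum_congr rfl fun i _ => by ring

/-- `|H(q, p + e) - H(q, p)| ≤ ‖e‖ (∑|p_i| + N/2)` for `‖e‖ ≤ 1`. [folklore] -/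
theorem abs_hamiltonian_momentum_shift_le (N : ℕ) (y : PhaseSpace N) {e : Fin N → ℝ}
    (he : ‖e‖ ≤ 1) :
    |P.hamiltonian N (y.1, y.2 + e) - P.hamiltonian N y| ≤ ‖e‖ * ((∑ i, |y.2 i|) + N / 2) := by
  rw [P.hamiltonian_momentum_shift]
  refine (Finset.abs_sum_le_sum_abs _ _).trans ?_
  have hei : ∀ i, |e i| ≤ ‖e‖ := fun i => by rw [← Real.norm_eq_abs]; exact norm_le_pi_norm e i
  have h0 : 0 ≤ ‖e‖ := norm_nonneg _
  calc ∑ i, |y.2 i * e i + e i ^ 2 / 2| ≤ ∑ i, (‖e‖ * |y.2 i| + ‖e‖ * (1 / 2)) :=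
        Finset.sum_le_sum fun i _ => by
          refine (abs_add_le _ _).trans (add_le_add ?_ ?_)
          · rw [abs_mul, mul_comm]
            exact mul_le_mul_of_nonneg_right (hei i) (abs_nonneg _)
          · rw [abs_of_nonneg (by positivity)]
            have h1 : e i ^ 2 ≤ ‖e‖ ^ 2 := by
              rw [← sq_abs]
              exact pow_le_pow_left₀ (abs_nonneg _) (hei i) 2
            nlinarith
    _ = ‖e‖ * ((∑ i, |y.2 i|) + N / 2) := by
        rw [Finset.sum_add_distrib, ← Finset.mul_sum]
        simp only [Finset.sum_const, Finset.card_univ, Fintype.card_fin, nsmul_eq_mul]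
        ring

namespace IsConfining

variable {P}

/-! ### Consequences of `IsConfining`: regularity, positivity, coercivity of `H` -/

/-- `U` is differentiable. [folklore] -/
theorem differentiable_U (hP : P.IsConfining) : Differentiable ℝ P.U := hP.contDiff_U.differentiable (by norm_num)

/-- `V` is differentiable. [folklore] -/
theorem differentiable_V (hP : P.IsConfining) : Differentiable ℝ P.V := hP.contDiff_V.differentiable (by norm_num)

/-- `H ∈ C²`. [folklore] -/
theorem contDiff_hamiltonian (hP : P.IsConfining) (N : ℕ) : ContDiff ℝ 2 (P.hamiltonian N) :=
  P.contDiff_hamiltonian hP.contDiff_U hP.contDiff_V N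

/-- `H` is differentiable. [folklore] -/
theorem differentiable_hamiltonian (hP : P.IsConfining) (N : ℕ) : Differentiable ℝ (P.hamiltonian N) :=
  (hP.contDiff_hamiltonian N).differentiable (by norm_num)

/-- `H ≥ 0`. [folklore] -/
theorem hamiltonian_nonneg (hP : P.IsConfining) (N : ℕ) (x : PhaseSpace N) : 0 ≤ P.hamiltonian N x :=
  P.hamiltonian_nonneg_of_nonneg hP.U_nonneg hP.V_nonneg N x

/-- Positions with bounded pinning energy are bounded: `U(q) ≤ E ⟹ |q| ≤ R(E)`. [folklore] -/
theorem exists_abs_le_of_U_le (hP : P.IsConfining) (E : ℝ) : ∃ R : ℝ, 0 ≤ R ∧ ∀ q, P.U q ≤ E → |q| ≤ R := by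
  obtain ⟨K, hK, hKU⟩ := mem_cocompact.1 (hP.tendsto_U (Ioi_mem_atTop E))
  obtain ⟨R, hR⟩ := hK.isBounded.subset_closedBall 0
  refine ⟨max R 0, le_max_right _ _, fun q hq => ?_⟩
  have hqK : q ∈ K := by
    by_contra h
    have h' : E < P.U q := hKU h
    exact absurd hq (not_le.2 h')
  have := hR hqK
  rw [mem_closedBall, dist_zero_right, Real.norm_eq_abs] at this
  exact this.trans (le_max_left _ _)

/-- **Coercivity of the energy**: the sublevel sets `{H ≤ E}` are compact. [folklore] -/
theorem isCompact_setOf_hamiltonian_le (hP : P.IsConfining) (N : ℕ) (E : ℝ) :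
    IsCompact {x : PhaseSpace N | P.hamiltonian N x ≤ E} := by
  obtain ⟨R, hR0, hR⟩ := hP.exists_abs_le_of_U_le E
  have hclosed : IsClosed {x : PhaseSpace N | P.hamiltonian N x ≤ E} :=
    isClosed_le (P.continuous_hamiltonian hP.contDiff_U.continuous hP.contDiff_V.continuous N)
      continuous_const
  refine (isCompact_closedBall (0 : PhaseSpace N) (max R (1 + |E|))).of_isClosed_subset hclosed ?_
  intro x hx
  have hx' : P.hamiltonian N x ≤ E := hx
  rw [mem_closedBall, dist_zero_right]
  have hsite := fun i => (P.site_le_hamiltonian hP.U_nonneg hP.V_nonneg N x i).trans hx'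
  have h0 : 0 ≤ max R (1 + |E|) := le_max_of_le_left hR0
  rw [Prod.norm_def, max_le_iff, pi_norm_le_iff_of_nonneg h0, pi_norm_le_iff_of_nonneg h0]
  refine ⟨fun i => ?_, fun i => ?_⟩
  · rw [Real.norm_eq_abs]
    refine le_max_of_le_left (hR _ ?_)
    have := hsite i
    nlinarith [sq_nonneg (x.2 i)]
  · rw [Real.norm_eq_abs]
    refine le_max_of_le_right ?_
    have h1 := hsite i
    have h2 : x.2 i ^ 2 / 2 ≤ |E| := by linarith [hP.U_nonneg (x.1 i), le_abs_self E]
    have h3 := abs_le_half_add_sq_half (x.2 i)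
    linarith

/-! ### The constants of the energy balance -/

/-- The constant `A` of `|U'| ≤ A(1 + U)`. [folklore] -/
def forceConstU (hP : P.IsConfining) : ℝ := Classical.choose hP.exists_abs_deriv_U_le

/-- The constant `B` of `|V'| ≤ B(1 + V)`. [folklore] -/
def forceConstV (hP : P.IsConfining) : ℝ := Classical.choose hP.exists_abs_deriv_V_le

/-- The defining property of `forceConstU`. [folklore] -/
theorem forceConstU_spec (hP : P.IsConfining) : 0 ≤ hP.forceConstU ∧ ∀ q, |deriv P.U q| ≤ hP.forceConstU * (1 + P.U q) :=
  Classical.choose_spec hP.exists_abs_deriv_U_le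

/-- The defining property of `forceConstV`. [folklore] -/
theorem forceConstV_spec (hP : P.IsConfining) : 0 ≤ hP.forceConstV ∧ ∀ r, |deriv P.V r| ≤ hP.forceConstV * (1 + P.V r) :=
  Classical.choose_spec hP.exists_abs_deriv_V_le

/-- **The energy-rate constant** `K_E = N (A + N² B) + γ (N + 2)` of the linear energy bound
`∑|∂_{q_i}H| + 2γ∑|p_i| ≤ K_E (1 + H)`. [folklore] -/
def energyRate (hP : P.IsConfining) (N : ℕ) : ℝ :=
  N * (hP.forceConstU + N ^ 2 * hP.forceConstV) + P.γ * (N + 2)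

/-- `K_E ≥ 0`. [folklore] -/
theorem energyRate_nonneg (hP : P.IsConfining) (N : ℕ) : 0 ≤ hP.energyRate N := by
  unfold energyRate
  have := hP.forceConstU_spec.1
  have := hP.forceConstV_spec.1
  have := hP.γ_nonneg
  positivity

/-- **The linear energy bound** `∑_i |∂_{q_i}H| + 2γ ∑_i |p_i| ≤ K_E (1 + H)`. [folklore] -/
theorem linearEnergyBound (hP : P.IsConfining) (N : ℕ) (x : PhaseSpace N) :
    (∑ i, |partialQ i (P.hamiltonian N) x|) + 2 * P.γ * ∑ i, |x.2 i| ≤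
      hP.energyRate N * (1 + P.hamiltonian N x) := by
  have h1 := P.sum_abs_partialQ_hamiltonian_le hP.forceConstU_spec.1 hP.forceConstV_spec.1
    hP.forceConstU_spec.2 hP.forceConstV_spec.2 hP.U_nonneg hP.V_nonneg hP.differentiable_U
    hP.differentiable_V N x
  have h2 := P.sum_abs_momentum_le hP.U_nonneg hP.V_nonneg N x
  have hH0 := hP.hamiltonian_nonneg N x
  have hγ := hP.γ_nonneg
  unfold energyRate
  have h3 : 2 * P.γ * ∑ i, |x.2 i| ≤ P.γ * (N + 2) * (1 + P.hamiltonian N x) := by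
    have := mul_le_mul_of_nonneg_left h2 (by positivity : 0 ≤ 2 * P.γ)
    nlinarith [mul_nonneg hγ hH0, mul_nonneg (mul_nonneg hγ (Nat.cast_nonneg N)) hH0]
  nlinarith

/-! ### The Langevin drift is a regular confined drift -/

/-- **The Langevin drift of a chain with confining potentials is a `RegularConfinedDrift`**:
energy `V = H` (`c = 1`), upper rate `K(M) = K_E M`, lower rate `K'(M) = K_E M + 4γ`, shift
constant `N + 1`, radius `levelRadius H`, noise subspace = momentum directions. This is the
deterministic non-explosion/regularity input of Khasminskii's theorem made pathwise (the pipeline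
`ConfinedForcedFlow.lean` … `ConfinedDynkin.lean`). [folklore] -/
def confinedDrift (hP : P.IsConfining) (N : ℕ) : RegularConfinedDrift (P.drift N) :=
  have hH : Differentiable ℝ (P.hamiltonian N) := hP.differentiable_hamiltonian N
  have hcpt : ∀ E : ℝ, IsCompact {x : PhaseSpace N | P.hamiltonian N x ≤ E} :=
    hP.isCompact_setOf_hamiltonian_le N
  { V := P.hamiltonian N
    c := 1
    K := fun M => hP.energyRate N * M
    ρ := levelRadius (P.hamiltonian N)
    noise := momentumSubspace N
    contDiff_drift := P.contDiff_one_drift hP.contDiff_U hP.contDiff_V N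
    differentiable_energy := hH
    energy_nonneg := fun y => by linarith [hP.hamiltonian_nonneg N y]
    rate_nonneg := fun M hM => mul_nonneg (hP.energyRate_nonneg N) hM
    fderiv_energy_le := fun M y e he heM => by
      rw [add_eq_of_mem_momentumSubspace he y]
      refine (P.fderiv_hamiltonian_drift_le hH hP.γ_nonneg y e.2).trans ?_
      have he2 : ‖e.2‖ ≤ M := (norm_eq_of_mem_momentumSubspace he) ▸ heM
      have hB := hP.linearEnergyBound N y
      have h0 : 0 ≤ (∑ i, |partialQ i (P.hamiltonian N) y|) + 2 * P.γ * ∑ i, |y.2 i| :=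
        add_nonneg (Finset.sum_nonneg fun i _ => abs_nonneg _)
          (mul_nonneg (mul_nonneg (by norm_num) hP.γ_nonneg) (Finset.sum_nonneg fun i _ => abs_nonneg _))
      calc ‖e.2‖ * ((∑ i, |partialQ i (P.hamiltonian N) y|) + 2 * P.γ * ∑ i, |y.2 i|)
          ≤ M * (hP.energyRate N * (1 + P.hamiltonian N y)) :=
            mul_le_mul he2 hB h0 ((norm_nonneg _).trans he2)
        _ = hP.energyRate N * M * (P.hamiltonian N y + 1) := by ring
    norm_le_radius := fun y B hy => norm_le_levelRadius hcpt hy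
    radius_mono := levelRadius_mono hcpt
    K' := fun M => hP.energyRate N * M + 4 * P.γ
    Kshift := N + 1
    rate_mono := fun M M' h => mul_le_mul_of_nonneg_left h (hP.energyRate_nonneg N)
    rate'_nonneg := fun M hM =>
      add_nonneg (mul_nonneg (hP.energyRate_nonneg N) hM) (mul_nonneg (by norm_num) hP.γ_nonneg)
    rate'_mono := fun M M' h => by
      have := mul_le_mul_of_nonneg_left h (hP.energyRate_nonneg N)
      linarith
    Kshift_nonneg := by positivity
    fderiv_energy_ge := fun M y e he heM => by
      rw [add_eq_of_mem_momentumSubspace he y]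
      refine le_trans ?_ (P.fderiv_hamiltonian_drift_ge hH hP.γ_nonneg y e.2)
      have he2 : ‖e.2‖ ≤ M := (norm_eq_of_mem_momentumSubspace he) ▸ heM
      have hB := hP.linearEnergyBound N y
      have hsq := P.sum_sq_momentum_le hP.U_nonneg hP.V_nonneg N y
      have hH0 := hP.hamiltonian_nonneg N y
      have hγ := hP.γ_nonneg
      have h0 : 0 ≤ (∑ i, |partialQ i (P.hamiltonian N) y|) + 2 * P.γ * ∑ i, |y.2 i| :=
        add_nonneg (Finset.sum_nonneg fun i _ => abs_nonneg _)
          (mul_nonneg (mul_nonneg (by norm_num) hγ) (Finset.sum_nonneg fun i _ => abs_nonneg _))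
      have h1 : ‖e.2‖ * ((∑ i, |partialQ i (P.hamiltonian N) y|) + 2 * P.γ * ∑ i, |y.2 i|) ≤
          M * (hP.energyRate N * (1 + P.hamiltonian N y)) :=
        mul_le_mul he2 hB h0 ((norm_nonneg _).trans he2)
      have h2 : 2 * P.γ * ∑ i, y.2 i ^ 2 ≤ 4 * P.γ * (P.hamiltonian N y + 1) := by
        have := mul_le_mul_of_nonneg_left hsq (by positivity : 0 ≤ 2 * P.γ)
        nlinarith
      nlinarith
    energy_shift_le := fun y e he he1 => by
      rw [add_eq_of_mem_momentumSubspace he y]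
      have hne : ‖e‖ = ‖e.2‖ := norm_eq_of_mem_momentumSubspace he
      have he1' : ‖e.2‖ ≤ 1 := hne ▸ he1
      refine (P.abs_hamiltonian_momentum_shift_le N y he1').trans ?_
      rw [← hne]
      have hp := P.sum_abs_momentum_le hP.U_nonneg hP.V_nonneg N y
      have hH0 := hP.hamiltonian_nonneg N y
      have h0 : 0 ≤ ‖e‖ := norm_nonneg _
      have h1 : (∑ i, |y.2 i|) + N / 2 ≤ (N + 1) * (P.hamiltonian N y + 1) := by
        have hN : (0 : ℝ) ≤ N := Nat.cast_nonneg N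
        nlinarith
      calc ‖e‖ * ((∑ i, |y.2 i|) + N / 2) ≤ ‖e‖ * ((N + 1) * (P.hamiltonian N y + 1)) :=
            mul_le_mul_of_nonneg_left h1 h0
        _ = (N + 1) * ‖e‖ * (P.hamiltonian N y + 1) := by ring }

/-- The energy of `confinedDrift` is the Hamiltonian. [folklore] -/
@[simp] theorem confinedDrift_V (hP : P.IsConfining) (N : ℕ) : (hP.confinedDrift N).V = P.hamiltonian N := rfl

/-- The noise subspace of `confinedDrift` is the momentum subspace. [folklore] -/
@[simp] theorem confinedDrift_noise (hP : P.IsConfining) (N : ℕ) : (hP.confinedDrift N).noise = momentumSubspace N := rfl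

/-- The bath directions lie in the noise subspace of `confinedDrift`. [folklore] -/
theorem bathVec_mem_noise (hP : P.IsConfining) (N k : ℕ) (c : ℝ) : bathVec N k c ∈ (hP.confinedDrift N).noise :=
  bathVec_mem_momentumSubspace N k c

end IsConfining

/-! ### The transition kernels of the Langevin chain -/

/-- The left bath direction `v_L = √(2γT_L) ∂_{p_0}`. [cite: CuneoEckmannHairerReyBellet2018, eq. (2.2)] -/
def bathVecL (N : ℕ) (T_L : ℝ) : PhaseSpace N := bathVec N 0 (Real.sqrt (2 * P.γ * T_L))

/-- The right bath direction `v_R = √(2γT_R) ∂_{p_{N-1}}`. [cite: CuneoEckmannHairerReyBellet2018, eq. (2.2)] -/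
def bathVecR (N : ℕ) (T_R : ℝ) : PhaseSpace N := bathVec N (N - 1) (Real.sqrt (2 * P.γ * T_R))

/-- **The solution map** `Φ_t(x, w)` of the Langevin SDE `dz = Y(z) dt + v_L dB^L + v_R dB^R` driven
by the pair of raw bath-noise paths `w` (the pathwise `drivenFlow` of the model-free pipeline).
[cite: CuneoEckmannHairerReyBellet2018, eq. (2.2)] -/
def langevinSolMap (N : ℕ) (T_L T_R : ℝ) (t : ℝ) (x : PhaseSpace N) (w : WienerPair) : PhaseSpace N :=
  sdeSolMap (P.drift N) (P.bathVecL N T_L) (P.bathVecR N T_R) t x w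

/-- **The transition kernels `P_t(x, ·) = law(Φ_t(x, B))` of the Langevin chain** (`B` the pair of
independent bath Brownian motions), via `sdeKernel` of the model-free pipeline (documented junk —
the zero kernel — when the solution map is not measurable; never the case under `IsConfining`).
[cite: CuneoEckmannHairerReyBellet2018, eq. (2.3)] -/
def langevinKernel (N : ℕ) (T_L T_R : ℝ) (t : ℝ≥0) : Kernel (PhaseSpace N) (PhaseSpace N) :=
  sdeKernel (P.drift N) (P.bathVecL N T_L) (P.bathVecR N T_R) t

/-- The generator of the chain IS the SDE generator `Df·Y + ½(D²f[v_L,v_L] + D²f[v_R,v_R])` of the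
pipeline on `C²` functions (`N ≥ 1`, `γT_L, γT_R ≥ 0`). [cite: CuneoEckmannHairerReyBellet2018, §3 eq. (3.2)] -/
theorem sdeGenerator_drift_eq_generator (hN : 0 < N) {T_L T_R : ℝ} (hL : 0 ≤ P.γ * T_L)
    (hR : 0 ≤ P.γ * T_R) {f : PhaseSpace N → ℝ} (hf : ContDiff ℝ 2 f) :
    sdeGenerator (P.drift N) (P.bathVecL N T_L) (P.bathVecR N T_R) f = P.generator N T_L T_R f := by
  funext y
  rw [sdeGenerator_def, generator_eq_fderiv_add_half P hN hL hR hf y]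
  rfl

namespace IsConfining

variable {P}

/-- `P_t(x, ·)` is the law of the solution map driven by the Brownian pair (no junk).
[cite: CuneoEckmannHairerReyBellet2018, eq. (2.3)] -/
theorem langevinKernel_apply (hP : P.IsConfining) (N : ℕ) (T_L T_R : ℝ) (t : ℝ≥0) (x : PhaseSpace N) :
    P.langevinKernel N T_L T_R t x =
      wienerPair.map fun w => P.langevinSolMap N T_L T_R t x (pairPath w) :=
  (hP.confinedDrift N).toConfinedDrift.sdeKernel_apply (hP.bathVec_mem_noise N _ _)
    (hP.bathVec_mem_noise N _ _) t x

/-- `P^t g(x) = E g(Φ_t(x, B))` for measurable `g ≥ 0`. [folklore] -/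
theorem lintegral_langevinKernel (hP : P.IsConfining) (N : ℕ) (T_L T_R : ℝ) (t : ℝ≥0) (x : PhaseSpace N) {g : PhaseSpace N → ℝ≥0∞}
    (hg : Measurable g) :
    ∫⁻ y, g y ∂(P.langevinKernel N T_L T_R t x) =
      ∫⁻ w, g (P.langevinSolMap N T_L T_R t x (pairPath w)) ∂wienerPair :=
  (hP.confinedDrift N).toConfinedDrift.lintegral_sdeKernel (hP.bathVec_mem_noise N _ _)
    (hP.bathVec_mem_noise N _ _) t x hg

/-- `P^t g(x) = E g(Φ_t(x, B))` for ae-strongly measurable real `g`. [folklore] -/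
theorem integral_langevinKernel (hP : P.IsConfining) (N : ℕ) (T_L T_R : ℝ) (t : ℝ≥0) (x : PhaseSpace N) {g : PhaseSpace N → ℝ}
    (hg : AEStronglyMeasurable g (P.langevinKernel N T_L T_R t x)) :
    ∫ y, g y ∂(P.langevinKernel N T_L T_R t x) =
      ∫ w, g (P.langevinSolMap N T_L T_R t x (pairPath w)) ∂wienerPair :=
  (hP.confinedDrift N).toConfinedDrift.integral_sdeKernel (hP.bathVec_mem_noise N _ _)
    (hP.bathVec_mem_noise N _ _) t x hg

/-- **No explosion**: the transition kernels are Markov kernels. [folklore] -/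
theorem isMarkovKernel_langevinKernel (hP : P.IsConfining) (N : ℕ) (T_L T_R : ℝ) (t : ℝ≥0) : IsMarkovKernel (P.langevinKernel N T_L T_R t) :=
  (hP.confinedDrift N).toConfinedDrift.isMarkovKernel_sdeKernel (hP.bathVec_mem_noise N _ _)
    (hP.bathVec_mem_noise N _ _) t

/-- Joint measurability of `(t, x) ↦ P_t(x, ·)`. [folklore] -/
theorem measurable_langevinKernel (hP : P.IsConfining) (N : ℕ) (T_L T_R : ℝ) :
    Measurable fun p : ℝ≥0 × PhaseSpace N => P.langevinKernel N T_L T_R p.1 p.2 :=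
  (hP.confinedDrift N).toConfinedDrift.measurable_sdeKernel (hP.bathVec_mem_noise N _ _)
    (hP.bathVec_mem_noise N _ _)

/-- `P_0 = id`. [folklore] -/
theorem langevinKernel_zero (hP : P.IsConfining) (N : ℕ) (T_L T_R : ℝ) : P.langevinKernel N T_L T_R 0 = Kernel.id :=
  (hP.confinedDrift N).toConfinedDrift.sdeKernel_zero (hP.bathVec_mem_noise N _ _)
    (hP.bathVec_mem_noise N _ _)

/-- **Chapman–Kolmogorov** `P_{s+t} = P_t ∘ₖ P_s`. [cite: CuneoEckmannHairerReyBellet2018, eq. (2.3)] -/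
theorem langevinKernel_add (hP : P.IsConfining) (N : ℕ) (T_L T_R : ℝ) (s t : ℝ≥0) :
    P.langevinKernel N T_L T_R (s + t) = P.langevinKernel N T_L T_R t ∘ₖ P.langevinKernel N T_L T_R s :=
  (hP.confinedDrift N).toConfinedDrift.sdeKernel_add (hP.bathVec_mem_noise N _ _)
    (hP.bathVec_mem_noise N _ _) s t

/-- **The Feller property**: `x ↦ P^t g(x)` is continuous for bounded continuous `g`. [folklore] -/
theorem continuous_integral_langevinKernel (hP : P.IsConfining) (N : ℕ) (T_L T_R : ℝ) (t : ℝ≥0) {g : PhaseSpace N → ℝ} (hg : Continuous g)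
    {C : ℝ} (hC : ∀ y, ‖g y‖ ≤ C) :
    Continuous fun x => ∫ y, g y ∂(P.langevinKernel N T_L T_R t x) :=
  (hP.confinedDrift N).toConfinedDrift.continuous_integral_sdeKernel (hP.bathVec_mem_noise N _ _)
    (hP.bathVec_mem_noise N _ _) t hg hC

/-- The Feller property, `BoundedContinuousFunction` form. [folklore] -/
theorem continuous_integral_langevinKernel_bcf (hP : P.IsConfining) (N : ℕ) (T_L T_R : ℝ) (t : ℝ≥0)
    (g : BoundedContinuousFunction (PhaseSpace N) ℝ) :
    Continuous fun x => ∫ y, g y ∂(P.langevinKernel N T_L T_R t x) :=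
  (hP.confinedDrift N).toConfinedDrift.continuous_integral_sdeKernel_bcf (hP.bathVec_mem_noise N _ _)
    (hP.bathVec_mem_noise N _ _) t g

/-- The solution map is continuous in time. [folklore] -/
theorem continuous_langevinSolMap (hP : P.IsConfining) (N : ℕ) (T_L T_R : ℝ) (x : PhaseSpace N) (w : WienerPair) :
    Continuous fun t => P.langevinSolMap N T_L T_R t x w :=
  (hP.confinedDrift N).toConfinedDrift.continuous_sdeSolMap (hP.bathVec_mem_noise N _ _)
    (hP.bathVec_mem_noise N _ _) x w

/-- The solution map is continuous in the initial condition. [folklore] -/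
theorem continuous_langevinSolMap_left (hP : P.IsConfining) (N : ℕ) (T_L T_R : ℝ) (t : ℝ) (w : WienerPair) :
    Continuous fun x => P.langevinSolMap N T_L T_R t x w :=
  (hP.confinedDrift N).toConfinedDrift.continuous_sdeSolMap_left (hP.bathVec_mem_noise N _ _)
    (hP.bathVec_mem_noise N _ _) t w

/-- The solution map driven by the Brownian pair is measurable for fixed `x`. [folklore] -/
theorem measurable_langevinSolMap_pairPath_right (hP : P.IsConfining) (N : ℕ) (T_L T_R : ℝ) (t : ℝ) (x : PhaseSpace N) :
    Measurable fun w : WienerPair => P.langevinSolMap N T_L T_R t x (pairPath w) :=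
  (hP.confinedDrift N).toConfinedDrift.measurable_sdeSolMap_pairPath_right
    (hP.bathVec_mem_noise N _ _) (hP.bathVec_mem_noise N _ _) t x

/-- **Dynkin's identity on `C²_c`** for the Langevin kernels:
`P_t f(z) - f(z) = ∫₀ᵗ P_s(Lf)(z) ds` with `L = P.generator N T_L T_R` (`N ≥ 1`, `T_L, T_R ≥ 0`).
[cite: CuneoEckmannHairerReyBellet2018, §3 eq. (3.2)] -/
theorem langevinKernel_dynkin (hP : P.IsConfining) (N : ℕ) (T_L T_R : ℝ) (hN : 0 < N) (hTL : 0 ≤ T_L) (hTR : 0 ≤ T_R)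
    {f : PhaseSpace N → ℝ} (hf : ContDiff ℝ 2 f) (hf' : HasCompactSupport f) (t : ℝ≥0)
    (z : PhaseSpace N) :
    ∫ y, f y ∂(P.langevinKernel N T_L T_R t z) - f z =
      ∫ s in (0 : ℝ)..(t : ℝ), ∫ y, P.generator N T_L T_R f y
        ∂(P.langevinKernel N T_L T_R s.toNNReal z) := by
  have h := (hP.confinedDrift N).sdeKernel_dynkin (v₁ := P.bathVecL N T_L) (v₂ := P.bathVecR N T_R)
    (hP.bathVec_mem_noise N _ _) (hP.bathVec_mem_noise N _ _) hf hf' t z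
  rw [P.sdeGenerator_drift_eq_generator hN (mul_nonneg hP.γ_nonneg hTL)
    (mul_nonneg hP.γ_nonneg hTR) hf] at h
  exact h

/-! ### The transition semigroup -/

/-- **The transition semigroup of a Langevin chain with confining potentials** (`N ≥ 1`,
`T_L, T_R ≥ 0`): the kernels `langevinKernel` ARE a `LangevinChainSemigroup P N T_L T_R` — Markov,
`P_0 = id`, Chapman–Kolmogorov, jointly measurable, Dynkin's identity on `C_c^∞`. For the
Hairer–Mattingly chain this is the object whose existence the fact
`Literature.Barriers.AtomisticToContinuum.HairerMattingly2009_threeOscillators` packages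
existentially ("Consider a SDE on `ℝⁿ` with smooth coefficients having global solutions").
[cite: HairerMattingly2009, Prop 5.1] -/
def semigroup (hP : P.IsConfining) (N : ℕ) (T_L T_R : ℝ) (hN : 0 < N) (hTL : 0 ≤ T_L) (hTR : 0 ≤ T_R) : LangevinChainSemigroup P N T_L T_R where
  kernel := P.langevinKernel N T_L T_R
  isMarkovKernel := hP.isMarkovKernel_langevinKernel N T_L T_R
  kernel_zero := hP.langevinKernel_zero N T_L T_R
  kernel_add := hP.langevinKernel_add N T_L T_R
  measurable_kernel := hP.measurable_langevinKernel N T_L T_R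
  dynkin := fun f hf hf' t z =>
    hP.langevinKernel_dynkin N T_L T_R hN hTL hTR (hf.of_le (by norm_cast)) hf' t z

/-- The kernels of the semigroup are `langevinKernel`. [folklore] -/
@[simp] theorem semigroup_kernel (hP : P.IsConfining) (N : ℕ) (T_L T_R : ℝ) (hN : 0 < N) (hTL : 0 ≤ T_L) (hTR : 0 ≤ T_R) (t : ℝ≥0) :
    (hP.semigroup N T_L T_R hN hTL hTR).kernel t = P.langevinKernel N T_L T_R t := rfl

/-- **The Feller property of the transition semigroup.** [folklore] -/
theorem continuous_act_semigroup (hP : P.IsConfining) (N : ℕ) (T_L T_R : ℝ) (hN : 0 < N) (hTL : 0 ≤ T_L) (hTR : 0 ≤ T_R) (t : ℝ≥0)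
    (g : BoundedContinuousFunction (PhaseSpace N) ℝ) :
    Continuous ((hP.semigroup N T_L T_R hN hTL hTR).act t g) :=
  hP.continuous_integral_langevinKernel_bcf N T_L T_R t g

/-- Dynkin's identity for the semigroup on `C²_c` (one derivative less than the interface
requires; used for `C²` Lyapunov functions). [folklore] -/
theorem semigroup_dynkin_two (hP : P.IsConfining) (N : ℕ) (T_L T_R : ℝ) (hN : 0 < N) (hTL : 0 ≤ T_L) (hTR : 0 ≤ T_R)
    {f : PhaseSpace N → ℝ} (hf : ContDiff ℝ 2 f) (hf' : HasCompactSupport f) (t : ℝ≥0)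
    (z : PhaseSpace N) :
    (hP.semigroup N T_L T_R hN hTL hTR).act t f z - f z =
      ∫ s in (0 : ℝ)..(t : ℝ),
        (hP.semigroup N T_L T_R hN hTL hTR).act s.toNNReal (P.generator N T_L T_R f) z :=
  hP.langevinKernel_dynkin N T_L T_R hN hTL hTR hf hf' t z

end IsConfining

end OscillatorChain

end Literature.MathematicalPhysics.KineticTheory.HeatConduction

end
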